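import Summits.HodgeConjecture.HodgeConjecture.Theses.NikulinTwinTransport
import Summits.HodgeConjecture.HodgeConjecture.Theorems.NikulinTwinTransportRealMultiplicationSqrtTwoAlgebraic
import Summits.HodgeConjecture.HodgeConjecture.Theorems.NikulinTwinTransportNikulinSerreCarrierBlockCriterionLattice
import Literature.AlgebraicGeometry.Surfaces.K3Surface
import Literature.AlgebraicGeometry.Surfaces.K3SurfaceProofs
import Literature.AlgebraicGeometry.Surfaces.K3Marking
import Literature.AlgebraicGeometry.Surfaces.K3HodgeTypes
import Literature.AlgebraicGeometry.HodgeTheory.LefschetzOneOne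
import Literature.AlgebraicGeometry.HodgeTheory.SupportedClassesHodgeConiveau

/-!
# Crux `NikulinSerreCarrier`, line `neron-severi-intertwiner` — stub S4 `stub_blockCriterion`:
# the Hodge block criterion, conditional core

Item stmt-HodgeConjecture-14464 (crux `NikulinTwinTransport.NikulinSerreCarrier`), line
`neron-severi-intertwiner`, registered stub `stub_blockCriterion` (S4). Its statement, with the
line's local definitions `IsTopGenerator`, `IsRationalHodgeTwoSimilitude`, `IsTranscendental`
unfolded (the "CORE"): for projective K3 surfaces `X, Y`, integral generators `p, p'` of `H⁴`, a
rational type-preserving `2`-similitude `Ψ : H²(Y) → H²(X)`, and a type-preserving `κ` which is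
rational up to a scalar `c ≠ 0`, equal to `m·Ψ` on the divisor classes
`NS(Y)_ℂ := algebraicClasses Y 1` and congruent to `m·Ψ` modulo `NS(X)_ℂ` on the transcendental
classes (`NS(Y)_ℂ^⊥`): `κ = m·Ψ`.

THIS FILE proves the CORE conditionally on four NAMED FACTS of the tree, all printed theorems:
`Huybrechts_K3_marking_exists` (markings, Huybrechts Ch. 1 Prop. 3.5), `Huybrechts_K3_hodgeTypes_H2`
(`H^{2,0} = ℂσ`, `H^{0,2} = ℂσ̄`, `H^{1,1} = ⟨σ,σ̄⟩^⊥`, Ch. 6 Prop. 1.2), `lefschetzOneOne_rational`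
(Lefschetz `(1,1)`, Voisin I Thm. 11.30) and `Grothendieck1969_supportedClasses_le_hodgeConiveau`
(divisor classes are of type `(1,1)`) — `blockCriterion_core_of_facts`; the main proof
`blockCriterion_core_of_lefschetzOneOneK3` takes Lefschetz `(1,1)` in the weaker form of the route's
own item `Theses.NikulinTwinTransport.LefschetzOneOneK3` (its K3 slice). The two inputs with no
named-fact dependence are in the sibling file `…BlockCriterionLattice`: the descent lemma
`ratLinearMap_eq_zero_of_irreducible` (Huybrechts Ch. 3 Lemma 3.1 in the form used) and the Hodge
index input `k3Rat_eq_zero_of_period` (signature `(3,19)`).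

PROOF (Huybrechts, *Lectures on K3 Surfaces*, Ch. 3 Lemma 3.1 and §3.2). Mark `X`, `Y`
(`η`, `η'`; periods `x`, `x'`; ample lattice vector `u' ∈ x'^⊥`). `λ := κ − m·Ψ` kills `NS(Y)_ℂ`;
`σ' = η'⁻¹x'` and `σ̄'` are transcendental (divisor classes are `(1,1)`, hence `⊥ σ', σ̄'`), so
`λσ' ∈ NS(X)_ℂ ⊆ H^{1,1}(X)`; but `λσ' ∈ H^{2,0}(X) = ℂσ` (types), and `ℂσ ∩ H^{1,1}(X) = 0`
(`(σ.σ̄) ≠ 0`): `λσ' = 0`, likewise `λσ̄' = 0`. The class `d = η'⁻¹u'` is integral of type `(1,1)`,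
hence a divisor class (Lefschetz), so `cκ d = cm·Ψ d` with `Ψ d ≠ 0` (`(Ψd)² = 2d² ≠ 0`): `cm ∈ ℚ`
and `L := η ∘ cλ ∘ η'⁻¹` is defined over `ℚ`. A rational `k` orthogonal to `ker L ∋ x', x̄'` and
to `NS(Y)_ℚ` is a rational `(1,1)`-class, hence in `NS(Y)_ℚ` (Lefschetz), hence `(k.k) = 0`,
`(k.u') = 0`, `(k.x') = 0`, hence `k = 0` (Hodge index, `k3Rat_eq_zero_of_period`); by descent
(`ratLinearMap_eq_zero_of_irreducible`) `L = 0`, i.e. `κ = m·Ψ`.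
-/

noncomputable section

set_option linter.dupNamespace false

namespace Summit.HodgeConjecture.HodgeConjecture.Theorems.NikulinSerreCarrier.NeronSeveriIntertwiner

open CategoryTheory
open Literature.AlgebraicGeometry Literature.AlgebraicGeometry.HodgeTheory
open Literature.AlgebraicGeometry.Surfaces
open Literature.AlgebraicTopology.SingularHomology
open Summit.HodgeConjecture.HodgeConjecture.Theorems.NikulinTwinTransport

/-- A complex scalar carrying a non-zero rational vector of `Λ_ℂ` to a rational vector is rational.
[folklore] -/
theorem exists_rat_of_smul_ratCast {a : ℂ} {w₁ w₂ : K3Index → ℚ}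
    (h : a • (fun i => (w₁ i : ℂ)) = fun i => (w₂ i : ℂ)) (hw : w₁ ≠ 0) : ∃ q : ℚ, a = q := by
  obtain ⟨i, hi⟩ := Function.ne_iff.1 hw
  have hi' : (w₁ i : ℂ) ≠ 0 := Rat.cast_ne_zero.2 hi
  have h1 := congrFun h i
  simp only [Pi.smul_apply, smul_eq_mul] at h1
  exact ⟨w₂ i / w₁ i, by rw [Rat.cast_div, eq_div_iff hi', h1]⟩

/-- **S4 `stub_blockCriterion`, conditional core (Hodge block criterion for projective K3
surfaces), with Lefschetz `(1,1)` in the form of the route's own item `LefschetzOneOneK3`.** Granted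
the named facts `Huybrechts_K3_marking_exists`, `Huybrechts_K3_hodgeTypes_H2`,
`Grothendieck1969_supportedClasses_le_hodgeConiveau` and the route item `LefschetzOneOneK3`
(Lefschetz `(1,1)` for projective K3 surfaces): for projective K3 surfaces `X, Y`, integral
generators `p, p'` of `H⁴`, a rational type-preserving `2`-similitude
`Ψ : H²(Y(ℂ); ℂ) → H²(X(ℂ); ℂ)`, a type-preserving `κ` rational up to a scalar `c ≠ 0`, and `m ≠ 0`
with `κ d = m·Ψ d` on `algebraicClasses Y 1` and `κ t − m·Ψ t ∈ algebraicClasses X 1` for every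
`t ⊥ algebraicClasses Y 1`, one has `κ = m·Ψ` — VERBATIM the registered stub with the line's local
definitions unfolded. Proof in the module docstring (irreducibility of the transcendental lattice,
Huybrechts Ch. 3 Lemma 3.1; Hodge index; Lefschetz `(1,1)`).
[cite: Huybrechts2016K3, Ch. 3 Lemma 3.1 and §3.2; Ch. 6 Prop. 1.2; Ch. 1 Prop. 3.5] -/
theorem blockCriterion_core_of_lefschetzOneOneK3 (hmark : Huybrechts_K3_marking_exists)
    (hHT : Huybrechts_K3_hodgeTypes_H2) (hL : Theses.NikulinTwinTransport.LefschetzOneOneK3)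
    (hG : Grothendieck1969_supportedClasses_le_hodgeConiveau) :
    ∀ (X Y : Motives.SchemeOver ℂ) (hX : Surfaces.IsK3Surface X) (hY : Surfaces.IsK3Surface Y)
      (p : complexBetti X (2 * 2)) (p' : complexBetti Y (2 * 2))
      (Ψ : complexBetti Y (2 * 1) →ₗ[ℂ] complexBetti X (2 * 1)),
      (IsIntegralClass p ∧ ∀ q : complexBetti X (2 * 2), IsIntegralClass q → ∃ n : ℤ, q = n • p) →
      (IsIntegralClass p' ∧ ∀ q : complexBetti Y (2 * 2), IsIntegralClass q → ∃ n : ℤ, q = n • p') →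
      ((∀ x, IsRationalClass x → IsRationalClass (Ψ x)) ∧
        (∀ (i j : ℕ) x, IsOfHodgeType 2 Y (2 * 1) i j x → IsOfHodgeType 2 X (2 * 1) i j (Ψ x)) ∧
        (∀ (x y : complexBetti Y (2 * 1)) (a : ℂ),
          cupProduct (rfl : 2 * 1 + 2 * 1 = 2 * 2) x y = a • p' →
            cupProduct (rfl : 2 * 1 + 2 * 1 = 2 * 2) (Ψ x) (Ψ y) = ((2 : ℂ) * a) • p)) →
      ∀ (κ : complexBetti Y (2 * 1) →ₗ[ℂ] complexBetti X (2 * 1)) (m : ℂ), m ≠ 0 →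
        (∃ c : ℂ, c ≠ 0 ∧ ∀ y, IsRationalClass y → IsRationalClass (c • κ y)) →
        (∀ (i j : ℕ) y, IsOfHodgeType 2 Y (2 * 1) i j y → IsOfHodgeType 2 X (2 * 1) i j (κ y)) →
        (∀ d ∈ algebraicClasses Y 1, κ d = m • Ψ d) →
        (∀ t : complexBetti Y (2 * 1),
            (∀ d ∈ algebraicClasses Y 1, cupProduct (rfl : 2 * 1 + 2 * 1 = 2 * 2) t d = 0) →
            κ t - m • Ψ t ∈ algebraicClasses X 1) →
          ∀ y, κ y = m • Ψ y := by
  intro X Y hX hY p p' Ψ hp hp' hΨ κ m hm hκrat hκtype hNS hT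
  obtain ⟨hΨrat, hΨtype, hΨsim⟩ := hΨ
  obtain ⟨c, hc, hκrat⟩ := hκrat
  -- markings of `X` and `Y`
  obtain ⟨η, p₀, x, hp₀, ⟨hp₀int, -, hηint, hηcup, h20, -⟩, ⟨-, hxpos, -⟩⟩ := hmark X hX
  obtain ⟨η', p₀', x', hp₀', ⟨hp₀'int, -, hη'int, hη'cup, h20', -⟩,
    ⟨hx'x', hx'pos, u', hu'x', hu'u'⟩⟩ := hmark Y hY
  -- the `(2,0)`-classes and the Hodge types on `H²`
  have hσ0 : η.symm x ≠ 0 := fun h0 =>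
    ne_zero_of_star_self_re_pos hxpos (by simpa using congrArg η h0)
  have hσ'0 : η'.symm x' ≠ 0 := fun h0 =>
    ne_zero_of_star_self_re_pos hx'pos (by simpa using congrArg η' h0)
  obtain ⟨h1X, h2X, h3X⟩ := hHT X hX _ h20 hσ0
  obtain ⟨h1Y, h2Y, h3Y⟩ := hHT Y hY _ h20' hσ'0
  have h02' : IsOfHodgeType 2 Y (2 * 1) 0 2
      (conjClass (Motives.ComplexPoints Y) (2 * 1) (η'.symm x')) :=
    hHT.conjClass_isOfHodgeType hY h20' hσ'0
  have hconj : conjClass (Motives.ComplexPoints X) (2 * 1) (η.symm x) = η.symm (star x) :=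
    conjClass_marking_symm η hηint x
  have hconj' : conjClass (Motives.ComplexPoints Y) (2 * 1) (η'.symm x') = η'.symm (star x') :=
    conjClass_marking_symm η' hη'int x'
  have hxne : k3Form (star x) x ≠ 0 := fun h => by
    rw [h, Complex.zero_re] at hxpos; exact lt_irrefl _ hxpos
  have hxne' : k3Form x (star x) ≠ 0 := by rwa [k3Form_comm]
  -- divisor classes are of type `(1,1)`, hence orthogonal to `σ'` and `σ̄'`
  have h11Y : ∀ d ∈ algebraicClasses Y 1, IsOfHodgeType 2 Y (2 * 1) 1 1 d := fun d hd =>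
    isOfHodgeType_oneOne_of_mem_algebraicClasses hG hY hd
  have h11X : ∀ d ∈ algebraicClasses X 1, IsOfHodgeType 2 X (2 * 1) 1 1 d := fun d hd =>
    isOfHodgeType_oneOne_of_mem_algebraicClasses hG hX hd
  have hsymm : ∀ a b : complexBetti Y (2 * 1),
      cupProduct (rfl : 2 * 1 + 2 * 1 = 2 * 2) a b = cupProduct (rfl : 2 * 1 + 2 * 1 = 2 * 2) b a :=
    fun a b => by rw [hη'cup, hη'cup, k3Form_comm]
  have hσ'T : ∀ d ∈ algebraicClasses Y 1,
      cupProduct (rfl : 2 * 1 + 2 * 1 = 2 * 2) (η'.symm x') d = 0 := fun d hd => by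
    rw [hsymm]; exact ((h3Y d).1 (h11Y d hd)).1
  have hσc'T : ∀ d ∈ algebraicClasses Y 1,
      cupProduct (rfl : 2 * 1 + 2 * 1 = 2 * 2)
        (conjClass (Motives.ComplexPoints Y) (2 * 1) (η'.symm x')) d = 0 := fun d hd => by
    rw [hsymm]; exact ((h3Y d).1 (h11Y d hd)).2
  -- `λ := κ − m·Ψ` kills `σ'` …
  have hlamσ' : κ (η'.symm x') - m • Ψ (η'.symm x') = 0 := by
    have hmem := hT _ hσ'T
    obtain ⟨t₁, ht₁⟩ := (h1X _).1 (hκtype 2 0 _ h20')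
    obtain ⟨t₂, ht₂⟩ := (h1X _).1 (hΨtype 2 0 _ h20')
    have heq : κ (η'.symm x') - m • Ψ (η'.symm x') = (t₁ - m * t₂) • η.symm x := by
      rw [ht₁, ht₂, sub_smul, mul_smul]
    have h2 := ((h3X _).1 (h11X _ hmem)).2
    rw [heq, hconj, map_smul, LinearMap.smul_apply, hηcup, LinearEquiv.apply_symm_apply,
      LinearEquiv.apply_symm_apply, smul_smul, smul_eq_zero] at h2
    rcases h2 with h2 | h2
    · rcases mul_eq_zero.1 h2 with h | h
      · rw [heq, h, zero_smul]
      · exact absurd h hxne'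
    · exact absurd h2 hp₀
  -- … and `σ̄'`
  have hlamσc' : κ (η'.symm (star x')) - m • Ψ (η'.symm (star x')) = 0 := by
    rw [← hconj']
    have hmem := hT _ hσc'T
    obtain ⟨t₁, ht₁⟩ := (h2X _).1 (hκtype 0 2 _ h02')
    obtain ⟨t₂, ht₂⟩ := (h2X _).1 (hΨtype 0 2 _ h02')
    have heq : κ (conjClass (Motives.ComplexPoints Y) (2 * 1) (η'.symm x')) -
        m • Ψ (conjClass (Motives.ComplexPoints Y) (2 * 1) (η'.symm x')) =
          (t₁ - m * t₂) • η.symm (star x) := by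
      rw [ht₁, ht₂, hconj, sub_smul, mul_smul]
    have h1 := ((h3X _).1 (h11X _ hmem)).1
    rw [heq, map_smul, LinearMap.smul_apply, hηcup, LinearEquiv.apply_symm_apply,
      LinearEquiv.apply_symm_apply, smul_smul, smul_eq_zero] at h1
    rcases h1 with h1 | h1
    · rcases mul_eq_zero.1 h1 with h | h
      · rw [heq, h, zero_smul]
      · exact absurd h hxne
    · exact absurd h1 hp₀
  -- the ample divisor class `d = η'⁻¹ u'`: integral, of type `(1,1)`, algebraic (Lefschetz)
  set d : complexBetti Y (2 * 1) := η'.symm (fun i => (u' i : ℂ)) with hd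
  have hdint : IsIntegralClass d := (hη'int d).2 ⟨u', by rw [hd, LinearEquiv.apply_symm_apply]⟩
  have hdrat : IsRationalClass d := hdint.isRationalClass
  have hu'star : star (fun i => (u' i : ℂ)) = fun i => (u' i : ℂ) := by
    funext i; simp
  have hu'x'bar : k3Form (fun i => (u' i : ℂ)) (star x') = 0 := by
    rw [← hu'star, ← star_k3Form, hu'x', star_zero]
  have hd11 : IsOfHodgeType 2 Y (2 * 1) 1 1 d := (h3Y d).2
    ⟨by rw [hη'cup, hd, LinearEquiv.apply_symm_apply, LinearEquiv.apply_symm_apply, hu'x',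
          zero_smul],
     by rw [hconj', hη'cup, hd, LinearEquiv.apply_symm_apply, LinearEquiv.apply_symm_apply,
          hu'x'bar, zero_smul]⟩
  have hdN : d ∈ algebraicClasses Y 1 := hL Y hY d hdrat hd11
  -- `p ≠ 0` and `Ψ d ≠ 0` (`(Ψd.Ψd) = 2 (d.d) ≠ 0`)
  have hp0 : p ≠ 0 := by
    obtain ⟨n, hn⟩ := hp.2 p₀ hp₀int
    rintro rfl
    exact hp₀ (by rw [hn, smul_zero])
  have hΨd : Ψ d ≠ 0 := by
    obtain ⟨n', hn'⟩ := hp'.2 p₀' hp₀'int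
    intro h0
    have hdd : cupProduct (rfl : 2 * 1 + 2 * 1 = 2 * 2) d d =
        (k3Form (fun i => (u' i : ℂ)) (fun i => (u' i : ℂ)) * (n' : ℂ)) • p' := by
      rw [hη'cup, hd, LinearEquiv.apply_symm_apply, hn', mul_smul, Int.cast_smul_eq_zsmul]
    have h2 := hΨsim d d _ hdd
    rw [h0] at h2
    simp only [map_zero] at h2
    have hne : (2 : ℂ) * (k3Form (fun i => (u' i : ℂ)) (fun i => (u' i : ℂ)) * (n' : ℂ)) ≠ 0 := by
      refine mul_ne_zero two_ne_zero (mul_ne_zero ?_ ?_)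
      · rw [k3Form_intCast]; exact_mod_cast hu'u'.ne'
      · intro hn0
        rw [show n' = 0 from Int.cast_eq_zero.1 hn0, zero_smul] at hn'
        exact hp₀' hn'
    rcases smul_eq_zero.1 h2.symm with h | h
    · exact hne h
    · exact hp0 h
  -- `c·m ∈ ℚ`
  obtain ⟨q, hq⟩ : ∃ q : ℚ, c * m = q := by
    obtain ⟨w₁, hw₁⟩ := (isRationalClass_iff_of_marking hX η hηint _).1 (hΨrat d hdrat)
    have hcv : IsRationalClass ((c * m) • Ψ d) := by
      have := hκrat d hdrat; rwa [hNS d hdN, smul_smul] at this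
    obtain ⟨w₂, hw₂⟩ := (isRationalClass_iff_of_marking hX η hηint _).1 hcv
    rw [map_smul, hw₁] at hw₂
    refine exists_rat_of_smul_ratCast hw₂ ?_
    rintro rfl
    apply hΨd
    apply η.injective
    rw [hw₁, map_zero]
    funext i; simp
  -- `φ := c·λ` is rational, so `L := η ∘ φ ∘ η'⁻¹` is defined over `ℚ`
  set φ : complexBetti Y (2 * 1) →ₗ[ℂ] complexBetti X (2 * 1) := c • (κ - m • Ψ) with hφ
  have hφapp : ∀ y, φ y = c • (κ y - m • Ψ y) := fun y => by
    simp only [hφ, LinearMap.smul_apply, LinearMap.sub_apply]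
  have hφrat : ∀ y, IsRationalClass y → IsRationalClass (φ y) := by
    intro y hy
    have : φ y = c • κ y + (((-q : ℚ)) : ℂ) • Ψ y := by
      rw [hφapp, smul_sub, smul_smul, hq, Rat.cast_neg, neg_smul, sub_eq_add_neg]
    rw [this]
    exact (hκrat y hy).add ((hΨrat y hy).smul (-q))
  set L : Module.End ℂ (K3Index → ℂ) := η.toLinearMap ∘ₗ φ ∘ₗ η'.symm.toLinearMap with hLdef
  have hLapp : ∀ z, L z = η (φ (η'.symm z)) := fun z => by
    simp only [hLdef, LinearMap.coe_comp, LinearEquiv.coe_coe, Function.comp_apply]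
  obtain ⟨ℓ, hℓ⟩ :=
    exists_ratEnd_of_forall_intCast L (markingConj_intCast hX η hηint η' hη'int φ hφrat)
  -- `L` kills `NS(Y)_ℚ`, `x'` and `x̄'`
  have hLN : ∀ n : K3Index → ℚ, η'.symm (fun i => (n i : ℂ)) ∈ algebraicClasses Y 1 →
      L (fun i => (n i : ℂ)) = 0 := fun n hn => by
    rw [hLapp, hφapp, hNS _ hn, sub_self, smul_zero, map_zero]
  have hLx' : L x' = 0 := by rw [hLapp, hφapp, hlamσ', smul_zero, map_zero]
  have hLx'bar : L (star x') = 0 := by rw [hLapp, hφapp, hlamσc', smul_zero, map_zero]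
  -- irreducibility: a rational `k` orthogonal to `ker L` vanishes (Lefschetz + Hodge index)
  have hirr : ∀ k : K3Index → ℚ, (∀ z, L z = 0 → k3FormC (fun i => (k i : ℂ)) z = 0) → k = 0 := by
    intro k hk
    set e : complexBetti Y (2 * 1) := η'.symm (fun i => (k i : ℂ)) with he
    have herat : IsRationalClass e := (isRationalClass_iff_of_marking hY η' hη'int e).2
      ⟨k, by rw [he, LinearEquiv.apply_symm_apply]⟩
    have hkx' : k3Form (fun i => (k i : ℂ)) x' = 0 := by simpa using hk x' hLx'
    have hkx'bar : k3Form (fun i => (k i : ℂ)) (star x') = 0 := by simpa using hk _ hLx'bar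
    have he11 : IsOfHodgeType 2 Y (2 * 1) 1 1 e := (h3Y e).2
      ⟨by rw [hη'cup, he, LinearEquiv.apply_symm_apply, LinearEquiv.apply_symm_apply, hkx',
            zero_smul],
       by rw [hconj', hη'cup, he, LinearEquiv.apply_symm_apply, LinearEquiv.apply_symm_apply,
            hkx'bar, zero_smul]⟩
    have heN : e ∈ algebraicClasses Y 1 := hL Y hY e herat he11
    have hkk : k3FormRat k k = 0 := by
      apply Rat.cast_injective (α := ℂ)
      rw [← k3Form_ratCast, Rat.cast_zero, ← k3FormC_apply]
      exact hk _ (hLN k heN)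
    have hku : k3FormRat k (fun i => (u' i : ℚ)) = 0 := by
      apply Rat.cast_injective (α := ℂ)
      rw [← k3Form_ratCast, Rat.cast_zero, ← k3FormC_apply, ← intCast_eq_ratCast_intCast]
      exact hk _ (hLN _ (by rw [← intCast_eq_ratCast_intCast]; exact hdN))
    exact k3Rat_eq_zero_of_period hx'x' hx'pos hu'x' hu'u' hkx' hku hkk
  -- descent: `L = 0`
  have hL0 : L = 0 :=
    ratLinearMap_eq_zero_of_irreducible k3FormRat k3FormRat_nondegenerate k3FormC
      (fun u v => by rw [k3FormC_apply, k3Form_ratCast]) ℓ L hℓ hirr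
  -- conclusion
  intro y
  have h := LinearMap.congr_fun hL0 (η' y)
  rw [hLapp, LinearEquiv.symm_apply_apply, LinearMap.zero_apply, map_eq_zero_iff _ η.injective,
    hφapp, smul_eq_zero] at h
  exact sub_eq_zero.1 (h.resolve_left hc)

/-- **S4 `stub_blockCriterion`, conditional core from the four NAMED FACTS of the tree**:
`Huybrechts_K3_marking_exists` (Huybrechts Ch. 1 Prop. 3.5), `Huybrechts_K3_hodgeTypes_H2` (Ch. 6
Prop. 1.2), `lefschetzOneOne_rational` (Voisin I Thm. 11.30) and
`Grothendieck1969_supportedClasses_le_hodgeConiveau` (divisor classes are of type `(1,1)`) imply the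
CORE of the registered stub (the K3 slice of `lefschetzOneOne_rational` is the route item
`LefschetzOneOneK3`, then `blockCriterion_core_of_lefschetzOneOneK3`).
[cite: Huybrechts2016K3, Ch. 3 Lemma 3.1 and §3.2] [cite: VoisinHodgeI2002, Thm. 11.30] -/
theorem blockCriterion_core_of_facts (hmark : Huybrechts_K3_marking_exists)
    (hHT : Huybrechts_K3_hodgeTypes_H2) (hL : lefschetzOneOne_rational)
    (hG : Grothendieck1969_supportedClasses_le_hodgeConiveau) :
    ∀ (X Y : Motives.SchemeOver ℂ) (hX : Surfaces.IsK3Surface X) (hY : Surfaces.IsK3Surface Y)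
      (p : complexBetti X (2 * 2)) (p' : complexBetti Y (2 * 2))
      (Ψ : complexBetti Y (2 * 1) →ₗ[ℂ] complexBetti X (2 * 1)),
      (IsIntegralClass p ∧ ∀ q : complexBetti X (2 * 2), IsIntegralClass q → ∃ n : ℤ, q = n • p) →
      (IsIntegralClass p' ∧ ∀ q : complexBetti Y (2 * 2), IsIntegralClass q → ∃ n : ℤ, q = n • p') →
      ((∀ x, IsRationalClass x → IsRationalClass (Ψ x)) ∧
        (∀ (i j : ℕ) x, IsOfHodgeType 2 Y (2 * 1) i j x → IsOfHodgeType 2 X (2 * 1) i j (Ψ x)) ∧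
        (∀ (x y : complexBetti Y (2 * 1)) (a : ℂ),
          cupProduct (rfl : 2 * 1 + 2 * 1 = 2 * 2) x y = a • p' →
            cupProduct (rfl : 2 * 1 + 2 * 1 = 2 * 2) (Ψ x) (Ψ y) = ((2 : ℂ) * a) • p)) →
      ∀ (κ : complexBetti Y (2 * 1) →ₗ[ℂ] complexBetti X (2 * 1)) (m : ℂ), m ≠ 0 →
        (∃ c : ℂ, c ≠ 0 ∧ ∀ y, IsRationalClass y → IsRationalClass (c • κ y)) →
        (∀ (i j : ℕ) y, IsOfHodgeType 2 Y (2 * 1) i j y → IsOfHodgeType 2 X (2 * 1) i j (κ y)) →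
        (∀ d ∈ algebraicClasses Y 1, κ d = m • Ψ d) →
        (∀ t : complexBetti Y (2 * 1),
            (∀ d ∈ algebraicClasses Y 1, cupProduct (rfl : 2 * 1 + 2 * 1 = 2 * 2) t d = 0) →
            κ t - m • Ψ t ∈ algebraicClasses X 1) →
          ∀ y, κ y = m • Ψ y :=
  blockCriterion_core_of_lefschetzOneOneK3 hmark hHT (fun _S hS c hc h11 => hL hS.1 c hc h11) hG

/-- **Registered sub-goal `stub_blockCriterionOfFacts` of S4** (pure `→`/`∀` shape, the form
registered on the crux item): the four named facts imply the CORE of `stub_blockCriterion`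
(= `blockCriterion_core_of_facts`). [cite: Huybrechts2016K3, Ch. 3 Lemma 3.1 and §3.2] -/
theorem stub_blockCriterionOfFacts :
    Literature.AlgebraicGeometry.Surfaces.Huybrechts_K3_marking_exists →
    Literature.AlgebraicGeometry.Surfaces.Huybrechts_K3_hodgeTypes_H2 →
    Literature.AlgebraicGeometry.HodgeTheory.lefschetzOneOne_rational →
    Literature.AlgebraicGeometry.HodgeTheory.Grothendieck1969_supportedClasses_le_hodgeConiveau →
    ∀ (X Y : Literature.AlgebraicGeometry.Motives.SchemeOver ℂ)
      (hX : Literature.AlgebraicGeometry.Surfaces.IsK3Surface X)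
      (hY : Literature.AlgebraicGeometry.Surfaces.IsK3Surface Y)
      (p : Literature.AlgebraicGeometry.HodgeTheory.complexBetti X (2 * 2))
      (p' : Literature.AlgebraicGeometry.HodgeTheory.complexBetti Y (2 * 2))
      (Ψ : Literature.AlgebraicGeometry.HodgeTheory.complexBetti Y (2 * 1) →ₗ[ℂ]
        Literature.AlgebraicGeometry.HodgeTheory.complexBetti X (2 * 1)),
      (Literature.AlgebraicGeometry.HodgeTheory.IsIntegralClass p ∧
        ∀ q : Literature.AlgebraicGeometry.HodgeTheory.complexBetti X (2 * 2),
          Literature.AlgebraicGeometry.HodgeTheory.IsIntegralClass q → ∃ n : ℤ, q = n • p) →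
      (Literature.AlgebraicGeometry.HodgeTheory.IsIntegralClass p' ∧
        ∀ q : Literature.AlgebraicGeometry.HodgeTheory.complexBetti Y (2 * 2),
          Literature.AlgebraicGeometry.HodgeTheory.IsIntegralClass q → ∃ n : ℤ, q = n • p') →
      ((∀ x, Literature.AlgebraicGeometry.HodgeTheory.IsRationalClass x →
          Literature.AlgebraicGeometry.HodgeTheory.IsRationalClass (Ψ x)) ∧
        (∀ (i j : ℕ) x, Literature.AlgebraicGeometry.HodgeTheory.IsOfHodgeType 2 Y (2 * 1) i j x →
          Literature.AlgebraicGeometry.HodgeTheory.IsOfHodgeType 2 X (2 * 1) i j (Ψ x)) ∧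
        (∀ (x y : Literature.AlgebraicGeometry.HodgeTheory.complexBetti Y (2 * 1)) (a : ℂ),
          Literature.AlgebraicTopology.SingularHomology.cupProduct (rfl : 2 * 1 + 2 * 1 = 2 * 2) x y = a • p' →
            Literature.AlgebraicTopology.SingularHomology.cupProduct (rfl : 2 * 1 + 2 * 1 = 2 * 2) (Ψ x) (Ψ y) =
              ((2 : ℂ) * a) • p)) →
      ∀ (κ : Literature.AlgebraicGeometry.HodgeTheory.complexBetti Y (2 * 1) →ₗ[ℂ]
          Literature.AlgebraicGeometry.HodgeTheory.complexBetti X (2 * 1)) (m : ℂ), m ≠ 0 →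
        (∃ c : ℂ, c ≠ 0 ∧ ∀ y, Literature.AlgebraicGeometry.HodgeTheory.IsRationalClass y →
          Literature.AlgebraicGeometry.HodgeTheory.IsRationalClass (c • κ y)) →
        (∀ (i j : ℕ) y, Literature.AlgebraicGeometry.HodgeTheory.IsOfHodgeType 2 Y (2 * 1) i j y →
          Literature.AlgebraicGeometry.HodgeTheory.IsOfHodgeType 2 X (2 * 1) i j (κ y)) →
        (∀ d ∈ Literature.AlgebraicGeometry.HodgeTheory.algebraicClasses Y 1, κ d = m • Ψ d) →
        (∀ t : Literature.AlgebraicGeometry.HodgeTheory.complexBetti Y (2 * 1),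
            (∀ d ∈ Literature.AlgebraicGeometry.HodgeTheory.algebraicClasses Y 1,
              Literature.AlgebraicTopology.SingularHomology.cupProduct (rfl : 2 * 1 + 2 * 1 = 2 * 2) t d = 0) →
            κ t - m • Ψ t ∈ Literature.AlgebraicGeometry.HodgeTheory.algebraicClasses X 1) →
          ∀ y, κ y = m • Ψ y :=
  fun hmark hHT hL hG => blockCriterion_core_of_facts hmark hHT hL hG

end Summit.HodgeConjecture.HodgeConjecture.Theorems.NikulinSerreCarrier.NeronSeveriIntertwiner

end
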